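import Summits.KontsevichZagierPeriods.Zeta5Search.LaiSweepShard

/-!
# `κ₃` sweep certificate — shard file 043 of 127 (shards 301–307 of 889)

HONEST FRAMING. Systematic search; no irrationality claim unless certified. This file only checks,
by `decide +kernel`, shards 301–307 of the order-cell sweep of the `κ₃` point `(74, 2180, 444; δ74)`
(engine `LaiSweepEngine`, soundness `LaiSweepJump/Free/Eval/Shard/Kappa3`; a shard is `⟨regime, n,
p, q, p', q', Lo, Up⟩`: `n` cells from `p/q` to `p'/q'` with integer rate sums in `[Lo, Up]`, `K =
128`, `D = 2^40`). It draws NO conclusion: only the capstone `LaiKappa3SweepCert`, which needs all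
127 shard files, does. Kernel cost of this file ≈ 560 cells × 0.3 s.
-/

namespace Summit.KontsevichZagierPeriods.Zeta5Search.Sweep

set_option maxHeartbeats 100000000 in
/-- Shard 301: 80 cells of regime B from `43/165` to `105/401`.
[cite: Lai2024BallRivoal, §4 Lemma 4.3] -/
theorem shard301 :
    Shard.check 128 (2^40)
      ⟨true, 80, 43, 165, 105, 401, 25246379329256, 26564965299486⟩ = true := by
  decide +kernel

set_option maxHeartbeats 100000000 in
/-- Shard 302: 80 cells of regime B from `105/401` to `316/1201`.
[cite: Lai2024BallRivoal, §4 Lemma 4.3] -/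
theorem shard302 :
    Shard.check 128 (2^40)
      ⟨true, 80, 105, 401, 316, 1201, 25703720428854, 27060627157976⟩ = true := by
  decide +kernel

set_option maxHeartbeats 100000000 in
/-- Shard 303: 80 cells of regime B from `316/1201` to `101/382`.
[cite: Lai2024BallRivoal, §4 Lemma 4.3] -/
theorem shard303 :
    Shard.check 128 (2^40)
      ⟨true, 80, 316, 1201, 101, 382, 25921218667103, 27305385027893⟩ = true := by
  decide +kernel

set_option maxHeartbeats 100000000 in
/-- Shard 304: 80 cells of regime B from `101/382` to `17/64`.
[cite: Lai2024BallRivoal, §4 Lemma 4.3] -/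
theorem shard304 :
    Shard.check 128 (2^40)
      ⟨true, 80, 101, 382, 17, 64, 24645484168076, 25975370937976⟩ = true := by
  decide +kernel

set_option maxHeartbeats 100000000 in
/-- Shard 305: 80 cells of regime B from `17/64` to `63/236`.
[cite: Lai2024BallRivoal, §4 Lemma 4.3] -/
theorem shard305 :
    Shard.check 128 (2^40)
      ⟨true, 80, 17, 64, 63, 236, 26469947821005, 27915897866440⟩ = true := by
  decide +kernel

set_option maxHeartbeats 100000000 in
/-- Shard 306: 80 cells of regime B from `63/236` to `48/179`.
[cite: Lai2024BallRivoal, §4 Lemma 4.3] -/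
theorem shard306 :
    Shard.check 128 (2^40)
      ⟨true, 80, 63, 236, 48, 179, 24084045946915, 25411742518163⟩ = true := by
  decide +kernel

set_option maxHeartbeats 100000000 in
/-- Shard 307: 80 cells of regime B from `48/179` to `111/412`.
[cite: Lai2024BallRivoal, §4 Lemma 4.3] -/
theorem shard307 :
    Shard.check 128 (2^40)
      ⟨true, 80, 48, 179, 111, 412, 25026604134794, 26421517503411⟩ = true := by
  decide +kernel

/-- The checked shards of this file, in order. [folklore] -/
def shards043 : List (CheckedShard 128 (2^40)) :=
  [⟨_, shard301⟩, ⟨_, shard302⟩, ⟨_, shard303⟩, ⟨_, shard304⟩, ⟨_, shard305⟩,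
    ⟨_, shard306⟩, ⟨_, shard307⟩]

end Summit.KontsevichZagierPeriods.Zeta5Search.Sweep
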